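/-
Copyright (c) 2026. All rights reserved.
Released under Apache 2.0 license as described in the file LICENSE.
-/
import Mathlib
import Summits.RiemannHypothesis.RiemannHypothesis.Theorems.HandoffLatticeDual
import Summits.RiemannHypothesis.RiemannHypothesis.Theorems.HandoffLatticeUncertaintyAux
import HarnessLib

/-!
# L-DUAL for `C²` compactly supported data, and its `L²` form

`HANDOFF/prove-1` gen15, ATTEMPT-22 §10. gen14's `dilationSum_eq_tsum_fourier` (file
`HandoffLatticeDual`) states the pointwise Poisson form of the lattice sum for SCHWARTZ `f`; the
programme's window vectors (`(1−x²)^m·polynomial` on the window, zero outside) are `C^{m−1}` with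
compact support, NOT Schwartz. This file proves the same identity for `C²` compactly supported data
(idea-1 §131.3 L-DUAL / L-DUAL-R request), using Mathlib's Poisson summation under `|x|^{-2}`
decay (`Real.tsum_eq_tsum_fourier_of_rpow_decay`) and the decay `‖𝓕F(ξ)‖ ≤ ‖F''‖₁/(4π²ξ²)`
(`Real.fourier_deriv` twice):

* `norm_fourier_le_of_deriv_two` — the `C²` Fourier decay;
* `dilationSum_eq_tsum_fourier_of_deriv_two` — **L-DUAL**: for `F` even, `C²`, supported in
  `[-λ, λ]`, `F 0 = 0`, `𝓕F 0 = 0`, and `u > 0`: `θ_F(u) = u⁻¹ Σ_{k≥1} 𝓕F(k/u)`;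
* `latticeTail_eq_integral_fourierSide` — **L-DUAL in `L²`**:
  `T_λ(F) = ∫_{(λ,∞)} ‖Σ_{k≥1} 𝓕F(kv)‖² dv` (substitution `u = 1/v`).

RH-free identities of classical analysis (Poisson summation); nothing here bears on RH.
-/

noncomputable section

set_option linter.dupNamespace false

open Complex MeasureTheory Set Filter Asymptotics
open scoped Real FourierTransform

namespace Summit.RiemannHypothesis.RiemannHypothesis.Theorems

namespace LatticeUncertainty

variable {F : ℝ → ℂ} {lam : ℝ}

/-! ## Fourier decay of `C²` compactly supported functions -/

/-- For `F` twice differentiable with `F''` continuous and `F` compactly supported: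
`𝓕(F'')(ξ) = (2πiξ)² 𝓕F(ξ)`. -/
theorem fourier_deriv_deriv (hd1 : Differentiable ℝ F) (hd2 : Differentiable ℝ (deriv F))
    (hc2 : Continuous (deriv (deriv F))) (hsupp : HasCompactSupport F) (ξ : ℝ) :
    𝓕 (deriv (deriv F)) ξ = (2 * π * I * ξ) ^ 2 * 𝓕 F ξ := by
  have hs1 : HasCompactSupport (deriv F) := hsupp.deriv
  have hs2 : HasCompactSupport (deriv (deriv F)) := hs1.deriv
  have hi0 : Integrable F := hd1.continuous.integrable_of_hasCompactSupport hsupp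
  have hi1 : Integrable (deriv F) := hd2.continuous.integrable_of_hasCompactSupport hs1
  have hi2 : Integrable (deriv (deriv F)) := hc2.integrable_of_hasCompactSupport hs2
  have e1 := Real.fourier_deriv hi0 hd1 hi1
  have e2 := Real.fourier_deriv hi1 hd2 hi2
  rw [e2]
  simp only [e1, smul_eq_mul]
  ring

/-- **`C²` Fourier decay.** `‖𝓕F(ξ)‖ ≤ ‖F''‖₁ / (4π²ξ²)` for `ξ ≠ 0`. -/
theorem norm_fourier_le_of_deriv_two (hd1 : Differentiable ℝ F) (hd2 : Differentiable ℝ (deriv F))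
    (hc2 : Continuous (deriv (deriv F))) (hsupp : HasCompactSupport F) {ξ : ℝ} (hξ : ξ ≠ 0) :
    ‖𝓕 F ξ‖ ≤ (∫ x, ‖deriv (deriv F) x‖) / (4 * π ^ 2 * ξ ^ 2) := by
  have h := fourier_deriv_deriv hd1 hd2 hc2 hsupp ξ
  have hc : (2 * π * I * ξ) ^ 2 = -(((4 * π ^ 2 * ξ ^ 2 : ℝ)) : ℂ) := by
    push_cast
    ring_nf
    rw [I_sq]
    ring
  have hpos : 0 < 4 * π ^ 2 * ξ ^ 2 := by positivity
  have hnorm : ‖𝓕 (deriv (deriv F)) ξ‖ = 4 * π ^ 2 * ξ ^ 2 * ‖𝓕 F ξ‖ := by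
    rw [h, hc, norm_mul, norm_neg, Complex.norm_real, Real.norm_of_nonneg hpos.le]
  rw [le_div_iff₀ hpos, mul_comm, ← hnorm]
  exact norm_fourier_le_integral_norm _ _

/-! ## L-DUAL for `C²` data -/

/-- A function supported in `[-λ, λ]` is eventually zero along the cocompact filter of `ℝ`, hence
`O` of anything there. -/
theorem isBigO_cocompact_of_support_subset {G : ℝ → ℂ} {M : ℝ}
    (hG : ∀ x, x ∉ Icc (-M) M → G x = 0) (g : ℝ → ℝ) : G =O[cocompact ℝ] g := by
  have h0 : G =ᶠ[cocompact ℝ] fun _ ↦ (0 : ℂ) := by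
    rw [cocompact_eq_atBot_atTop]
    refine Filter.eventually_sup.mpr ⟨?_, ?_⟩
    · filter_upwards [eventually_lt_atBot (-M)] with x hx
      exact hG x fun h ↦ not_le.mpr hx h.1
    · filter_upwards [eventually_gt_atTop M] with x hx
      exact hG x fun h ↦ not_le.mpr hx h.2
  exact (isBigO_zero _ _).congr' h0.symm EventuallyEq.rfl

/-- **L-DUAL (pointwise Poisson form) for `C²` compactly supported data.** For `F` even, twice
differentiable with continuous `F''`, supported in `[-λ, λ]`, with `F 0 = 0` and `𝓕F 0 = 0`
(i.e. `∫ F = 0`), and every `u > 0`: `dilationSum λ F u = u⁻¹ · Σ_{k ≥ 1} 𝓕F(k/u)`.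
(idea-1 §131.1 (L-DUAL); Connes–Consani's map `ℰ`; Mathlib Poisson summation under
`|x|^{-2}` decay.) -/
theorem dilationSum_eq_tsum_fourier_of_deriv_two (hd1 : Differentiable ℝ F)
    (hd2 : Differentiable ℝ (deriv F)) (hc2 : Continuous (deriv (deriv F)))
    (hsupp : ∀ x, x ∉ Icc (-lam) lam → F x = 0) (heven : ∀ x, F (-x) = F x) (h0 : F 0 = 0)
    (hmass : 𝓕 F 0 = 0) {u : ℝ} (hu : 0 < u) :
    dilationSum lam F u = (u : ℂ)⁻¹ * ∑' k : ℕ+, 𝓕 F ((k : ℕ) / u) := by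
  have hcs : HasCompactSupport F :=
    HasCompactSupport.intro isCompact_Icc fun x hx ↦ hsupp x hx
  set g : ℝ → ℂ := fun x ↦ F (x * u) with hg
  -- decay hypotheses for Poisson summation
  have hg_cont : Continuous g := hd1.continuous.comp (continuous_id.mul continuous_const)
  have hg_supp : ∀ x, x ∉ Icc (-(lam / u)) (lam / u) → g x = 0 := by
    intro x hx
    apply hsupp
    intro h
    apply hx
    constructor
    · rw [← neg_div, div_le_iff₀ hu]; exact h.1
    · rw [le_div_iff₀ hu]; exact h.2
  have hg_decay : g =O[cocompact ℝ] fun x : ℝ ↦ |x| ^ (-(2 : ℝ)) :=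
    isBigO_cocompact_of_support_subset hg_supp _
  have hFg : ∀ ξ : ℝ, 𝓕 g ξ = (u⁻¹ : ℝ) • 𝓕 F (ξ / u) := fun ξ ↦ fourier_comp_mul_right F hu ξ
  set C : ℝ := (∫ x, ‖deriv (deriv F) x‖) / (4 * π ^ 2) with hC
  have hC0 : 0 ≤ C := by positivity
  have hFg_decay : (𝓕 g) =O[cocompact ℝ] fun x : ℝ ↦ |x| ^ (-(2 : ℝ)) := by
    refine IsBigO.of_bound (C * u) ?_
    have hne : ∀ᶠ ξ : ℝ in cocompact ℝ, ξ ≠ 0 := by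
      rw [cocompact_eq_atBot_atTop]
      exact Filter.eventually_sup.mpr
        ⟨(eventually_lt_atBot (0 : ℝ)).mono fun x hx ↦ hx.ne,
          (eventually_gt_atTop (0 : ℝ)).mono fun x hx ↦ hx.ne'⟩
    filter_upwards [hne] with ξ hξ
    have hξu : ξ / u ≠ 0 := div_ne_zero hξ hu.ne'
    rw [hFg, norm_smul, Real.norm_of_nonneg (inv_nonneg.mpr hu.le), Real.norm_of_nonneg
      (Real.rpow_nonneg (abs_nonneg ξ) _)]
    calc u⁻¹ * ‖𝓕 F (ξ / u)‖
        ≤ u⁻¹ * ((∫ x, ‖deriv (deriv F) x‖) / (4 * π ^ 2 * (ξ / u) ^ 2)) :=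
          mul_le_mul_of_nonneg_left (norm_fourier_le_of_deriv_two hd1 hd2 hc2 hcs hξu)
            (inv_nonneg.mpr hu.le)
      _ = C * u * |ξ| ^ (-(2 : ℝ)) := by
          rw [Real.rpow_neg (abs_nonneg ξ), Real.rpow_two, sq_abs, hC]
          field_simp
  -- Poisson summation for `g` at `x = 0`
  have hP := Real.tsum_eq_tsum_fourier_of_rpow_decay hg_cont one_lt_two hg_decay hFg_decay 0
  simp only [zero_add, QuotientAddGroup.mk_zero, fourier_eval_zero, mul_one] at hP
  -- summability and parity on `ℤ`
  have hsum_g : Summable fun n : ℤ ↦ g n :=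
    summable_of_isBigO (Real.summable_abs_int_rpow one_lt_two)
      (hg_decay.comp_tendsto Int.tendsto_coe_cofinite)
  have hsum_Fg : Summable fun n : ℤ ↦ 𝓕 g n :=
    summable_of_isBigO (Real.summable_abs_int_rpow one_lt_two)
      (hFg_decay.comp_tendsto Int.tendsto_coe_cofinite)
  have hg_even : (fun n : ℤ ↦ g n).Even := fun n ↦ by
    simp only [hg, Int.cast_neg, neg_mul, heven]
  have hFf_even : ∀ ξ : ℝ, 𝓕 F (-ξ) = 𝓕 F ξ := fun ξ ↦ by
    rw [Real.fourier_real_eq, Real.fourier_real_eq, ← integral_neg_eq_self]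
    refine integral_congr_ae (Eventually.of_forall fun v ↦ ?_)
    simp only [neg_mul, mul_neg, neg_neg, heven]
  have hFg_even : (fun n : ℤ ↦ 𝓕 g n).Even := fun n ↦ by
    change 𝓕 g ((-n : ℤ) : ℝ) = 𝓕 g (n : ℝ)
    rw [hFg, hFg, Int.cast_neg, neg_div, hFf_even]
  rw [tsum_int_eq_zero_add_two_mul_tsum_pnat hg_even hsum_g,
    tsum_int_eq_zero_add_two_mul_tsum_pnat hFg_even hsum_Fg] at hP
  have hg0 : g (0 : ℤ) = 0 := by simp [hg, h0]
  have hFg0 : 𝓕 g (0 : ℤ) = 0 := by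
    rw [hFg, Int.cast_zero, zero_div, hmass, smul_zero]
  rw [hg0, hFg0, zero_add, zero_add, two_nsmul, two_nsmul, ← two_mul, ← two_mul] at hP
  have hP' : ∑' n : ℕ+, g (n : ℤ) = ∑' n : ℕ+, 𝓕 g (n : ℤ) := mul_left_cancel₀ two_ne_zero hP
  have hsupp' : ∀ x, lam < x → F x = 0 := fun x hx ↦ hsupp x fun h ↦ not_lt.mpr h.2 hx
  have hL : ∑' n : ℕ+, g (n : ℤ) = dilationSum lam F u := by
    rw [← tsum_pnat_eq_dilationSum F hu hsupp']
    exact tsum_congr fun n ↦ by simp [hg]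
  have hR : ∑' n : ℕ+, 𝓕 g (n : ℤ) = (u : ℂ)⁻¹ * ∑' k : ℕ+, 𝓕 F ((k : ℕ) / u) := by
    rw [← tsum_mul_left]
    refine tsum_congr fun n ↦ ?_
    rw [hFg, Complex.real_smul]
    push_cast
    rfl
  rw [← hL, hP', hR]

/-! ## L-DUAL in `L²`: the lattice tail as an exterior Fourier integral -/

/-- **L-DUAL, `L²` form.** Under the hypotheses of `dilationSum_eq_tsum_fourier_of_deriv_two` and
`λ > 0`: `latticeTail λ F = ∫_{(λ,∞)} ‖Σ_{k ≥ 1} 𝓕F(kv)‖² dv` (substitute `u = 1/v`).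
(idea-1 §131.1: `T(f) = ∫_λ^∞ |Σ_{k≥1} 𝓕f(kv)|² dv`.) -/
theorem latticeTail_eq_integral_fourierSide (hlam : 0 < lam) (hd1 : Differentiable ℝ F)
    (hd2 : Differentiable ℝ (deriv F)) (hc2 : Continuous (deriv (deriv F)))
    (hsupp : ∀ x, x ∉ Icc (-lam) lam → F x = 0) (heven : ∀ x, F (-x) = F x) (h0 : F 0 = 0)
    (hmass : 𝓕 F 0 = 0) :
    latticeTail lam F = ∫ v in Ioi lam, ‖∑' k : ℕ+, 𝓕 F ((k : ℕ) * v)‖ ^ 2 := by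
  -- `T = ∫_{(0,∞)} 1_{(0,1/λ]} ‖θ‖²`; substitute `y = x⁻¹` (`integral_comp_rpow_Ioi`, `p = -1`)
  set G : ℝ → ℝ := fun y ↦ (Ioc 0 (1 / lam)).indicator (fun y ↦ ‖dilationSum lam F y‖ ^ 2) y
    with hG
  set h : ℝ → ℝ := fun v ↦ ‖∑' k : ℕ+, 𝓕 F ((k : ℕ) * v)‖ ^ 2 with hh
  have hT : latticeTail lam F = ∫ y in Ioi 0, G y := by
    rw [latticeTail, hG, setIntegral_indicator measurableSet_Ioc,
      Set.inter_eq_self_of_subset_right Ioc_subset_Ioi_self]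
  have hsub := integral_comp_rpow_Ioi G (p := -1) (by norm_num)
  have hpt : ∀ x ∈ Ioi (0 : ℝ),
      (|(-1 : ℝ)| * x ^ ((-1 : ℝ) - 1)) • G (x ^ (-1 : ℝ)) = (Ici lam).indicator h x := by
    intro x hx
    have hx0 : 0 < x := hx
    rw [Real.rpow_neg_one, show (-1 : ℝ) - 1 = -2 by norm_num, abs_neg, abs_one, one_mul,
      smul_eq_mul]
    by_cases hxl : lam ≤ x
    · have hmem : x⁻¹ ∈ Ioc 0 (1 / lam) :=
        ⟨inv_pos.mpr hx0, by rw [one_div]; exact (inv_le_inv₀ hx0 hlam).mpr hxl⟩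
      have hGx : G x⁻¹ = ‖dilationSum lam F x⁻¹‖ ^ 2 := by simp only [hG, indicator_of_mem hmem]
      rw [hGx, indicator_of_mem (mem_Ici.mpr hxl), hh,
        dilationSum_eq_tsum_fourier_of_deriv_two hd1 hd2 hc2 hsupp heven h0 hmass
          (inv_pos.mpr hx0)]
      have e : ∀ k : ℕ+, 𝓕 F ((k : ℕ) / x⁻¹) = 𝓕 F ((k : ℕ) * x) := fun k ↦ by
        rw [div_inv_eq_mul]
      simp_rw [e]
      rw [norm_mul, mul_pow, Complex.ofReal_inv, inv_inv, Complex.norm_real,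
        Real.norm_of_nonneg hx0.le, Real.rpow_neg hx0.le, Real.rpow_two]
      field_simp
    · have hnot : x⁻¹ ∉ Ioc 0 (1 / lam) := fun hm ↦ hxl (by
        have h2 := hm.2
        rw [one_div, inv_le_inv₀ hx0 hlam] at h2
        exact h2)
      have hGx : G x⁻¹ = 0 := by simp only [hG, indicator_of_notMem hnot]
      rw [hGx, indicator_of_notMem (fun hm ↦ hxl (mem_Ici.mp hm)), mul_zero]
  rw [hT, ← hsub, setIntegral_congr_fun measurableSet_Ioi hpt, setIntegral_indicator
    measurableSet_Ici, show Ioi (0 : ℝ) ∩ Ici lam = Ici lam from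
      Set.inter_eq_self_of_subset_right fun v hv ↦ hlam.trans_le (mem_Ici.mp hv),
    integral_Ici_eq_integral_Ioi]

end LatticeUncertainty

end Summit.RiemannHypothesis.RiemannHypothesis.Theorems
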